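import Literature.NumberTheory.PAdicHodge.DualExpElliptic
import Literature.NumberTheory.EllipticCurves.ComplexMultiplicationLFunctionIsogenyProofs
import Literature.NumberTheory.GaloisRepresentations.PotentialDiagonalizabilityCriteriaProofs
import HarnessLib

/-!
# De Rham-ness (indeed `B`-admissibility for any period-ring datum) of the rational Tate module of an
# elliptic curve is an ISOGENY INVARIANT

Topic `Literature/NumberTheory/PAdicHodge`; sibling of `DeRhamEllipticBaseChange` (restriction ↔ base change) and
`DeRhamRestrictedTateRepTower` (towers). THEOREMS ONLY (no definition, no named fact, no `sorry`).

For elliptic curves `W ∼ W'` isogenous over a field `K₀` of characteristic `≠ p`, an isogeny `φ : W → W'`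
induces a `Γ_{K₀}`-equivariant ISOMORPHISM `V_p φ : V_p W ⥲ V_p W'` (Silverman *AEC* III.7.4 with III.7.1(a);
tree `WeierstrassCurve.Isogeny.rationalTateModuleEquiv`, `…_smul`, file
`EllipticCurves/ComplexMultiplicationLFunctionIsogenyProofs`), and `B`-admissibility of a representation is invariant
under isomorphism (Fontaine, Astérisque 223, Exp. III §1.5; tree `PeriodRingData.isAdmissible_iff_of_equiv`). Hence,
for EVERY continuous homomorphism `r : Γ → Γ_{K₀}` (a decomposition group, `absGaloisRestrict K₀ F`, a place
restriction `galRestrictPlace v`, a tower `Γ_{L_w} → Γ_{ℚ_v} → Γ_ℚ`, …) and EVERY period-ring datum `𝔅` over `Γ`: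

* `WeierstrassCurve.Isogeny.isAdmissible_restrict_rationalTateGaloisRep_iff` —
  `𝔅`-admissibility of `V_pW|_r` ⟺ of `V_pW'|_r`;
* `isDeRham_restrictedRationalTateRep_iff_of_isogeny` / `…_of_isIsogenous` — for a `p`-adic field `F ⊇ K₀`
  (`char K₀ = 0`): `V_pW|_{Γ_F}` is de Rham (tree `GaloisRep.IsDeRham (bdRPeriodRingData hp)`, the currency of the
  cite-only fact `isDeRham_restrictedRationalTateRep`) iff `V_pW'|_{Γ_F}` is;
* `isDeRham_restrictedRationalTateRep_of_isIsogenous` — the one-way transport used by consumers.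

WHY (BSD crux K★ `StarredOptimalManinUnitFiveSeven`, stmt-BirchSwinnertonDyer-22226, line `kato-lever`, stub hDR): the
per-curve de Rham theorems of the tree (good ordinary `isDeRham_restrictedRationalTateRep_of_goodOrdinary`, potentially
good ordinary over `ℚ` `…_adicCompletion_of_potentiallyGoodOrdinary`, the three (G)-ordinary K★ cells) are stated for ONE
model, while Kato's Euler-system argument reads `V_p` at Kato's member `W′` of the isogeny class and the Manin levers at the
`X₀(N)`-optimal member; this file moves de Rham-ness across the class. BSD is not proved by any of this; hDR stays
cite-only.

## References
* J. H. Silverman, *The Arithmetic of Elliptic Curves*, 2nd ed. (2009), Prop. III.7.1(a), Thm. III.7.4. [SilvermanAEC2009]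
* J.-M. Fontaine, *Représentations p-adiques semi-stables*, Astérisque 223 (1994), Exp. III §1.5. [FontaineAsterisque223III]
* G. Faltings, Invent. Math. 73 (1983), §5 Korollar 2 ((i) ⇒ (ii): `V_ℓ` of isogenous curves are isomorphic). [Faltings1983Endlichkeit]
-/

noncomputable section

open Field ValuativeRel

namespace WeierstrassCurve.Isogeny

open Literature.NumberTheory.GaloisRepresentations Literature.NumberTheory.EllipticCurves

universe u v' w

variable {K₀ : Type} [Field K₀] {W W' : WeierstrassCurve K₀} [W.IsElliptic] [W'.IsElliptic]

/-- **`B`-admissibility of `V_p` restricted along any `r : Γ → Γ_{K₀}` is an isogeny invariant.** For an isogeny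
`φ : W → W'` of elliptic curves over `K₀` with `(p : K₀) ≠ 0`, a continuous homomorphism `r : Γ → Γ_{K₀}` and a
period-ring datum `𝔅` over `Γ` with coefficients `ℚ_p`: `V_pW|_r` is `𝔅`-admissible iff `V_pW'|_r` is — transport
along the `Γ_{K₀}`-equivariant isomorphism `V_p φ` (`rationalTateModuleEquiv`, `rationalTateModuleEquiv_smul`) by
`PeriodRingData.isAdmissible_iff_of_equiv`.
[cite: SilvermanAEC2009, Prop. III.7.1(a) and Thm. III.7.4] [cite: FontaineAsterisque223III, Exp. III §1.5] -/
theorem isAdmissible_restrict_rationalTateGaloisRep_iff (φ : Isogeny W W') (p : ℕ) [Fact p.Prime]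
    (hp : (p : K₀) ≠ 0) {Γ : Type u} [Group Γ] [TopologicalSpace Γ] (r : Γ →ₜ* absoluteGaloisGroup K₀)
    {E : Type v'} [Field E] [Algebra ℚ_[p] E] (𝔅 : PeriodRingData.{u, 0, v', w} Γ ℚ_[p] E) :
    𝔅.IsAdmissible ((W.rationalTateGaloisRep p (W.continuous_rationalGaloisRepTate_holds p)).restrict r) ↔
      𝔅.IsAdmissible ((W'.rationalTateGaloisRep p (W'.continuous_rationalGaloisRepTate_holds p)).restrict r) :=
  𝔅.isAdmissible_iff_of_equiv _ _ (φ.rationalTateModuleEquiv p hp) fun σ x => by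
    simp only [ContinuousRep.restrict_apply]
    exact φ.rationalTateModuleEquiv_smul p hp (r σ) x

end WeierstrassCurve.Isogeny

namespace Literature.NumberTheory.PAdicHodge

open Literature.NumberTheory.GaloisRepresentations
open Literature.NumberTheory.GaloisRepresentations.IsNonarchimedeanLocalField
open Literature.NumberTheory.EllipticCurves WeierstrassCurve

variable {F : Type} [Field F] [ValuativeRel F] [TopologicalSpace F] [IsNonarchimedeanLocalField F]
  [CharZero F] {p : ℕ} [Fact p.Prime] [Fact (¬ IsUnit (p : integerC F))]
  [IsAdicComplete (Ideal.span {(p : integerC F)}) (integerC F)] (hp : valuation F p < 1) [Algebra ℚ_[p] F]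
  {K₀ : Type} [Field K₀] [CharZero K₀] [Algebra K₀ F] {W W' : WeierstrassCurve K₀} [W.IsElliptic] [W'.IsElliptic]

/-- **`V_pW|_{Γ_F}` is de Rham iff `V_pW'|_{Γ_F}` is, for an isogeny `φ : W → W'` over `K₀ ⊆ F`** (`char K₀ = 0`,
`F` a `p`-adic field, the tree's `B_dR(F)` datum `bdRPeriodRingData hp`; the representations are the restricted
ones of the cite-only fact `isDeRham_restrictedRationalTateRep`).
[cite: SilvermanAEC2009, Prop. III.7.1(a) and Thm. III.7.4] [cite: FontaineAsterisque223III, Exp. III §1.5] -/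
theorem isDeRham_restrictedRationalTateRep_iff_of_isogeny (φ : Isogeny W W') :
    GaloisRep.IsDeRham (bdRPeriodRingData (F := F) (p := p) hp) (restrictedRationalTateRep W F p) ↔
      GaloisRep.IsDeRham (bdRPeriodRingData (F := F) (p := p) hp) (restrictedRationalTateRep W' F p) :=
  φ.isAdmissible_restrict_rationalTateGaloisRep_iff p (Nat.cast_ne_zero.2 (Fact.out : p.Prime).ne_zero)
    (absGaloisRestrict K₀ F) (bdRPeriodRingData (F := F) (p := p) hp)

/-- **De Rham-ness of `V_p|_{Γ_F}` is constant on a `K₀`-isogeny class** (`IsIsogenous W W'`, i.e. an isogeny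
`W → W'` over `K₀` exists). [cite: SilvermanAEC2009, Prop. III.7.1(a) and Thm. III.7.4]
[cite: FontaineAsterisque223III, Exp. III §1.5] -/
theorem isDeRham_restrictedRationalTateRep_iff_of_isIsogenous (h : IsIsogenous W W') :
    GaloisRep.IsDeRham (bdRPeriodRingData (F := F) (p := p) hp) (restrictedRationalTateRep W F p) ↔
      GaloisRep.IsDeRham (bdRPeriodRingData (F := F) (p := p) hp) (restrictedRationalTateRep W' F p) := by
  obtain ⟨φ⟩ := h
  exact isDeRham_restrictedRationalTateRep_iff_of_isogeny hp φ

/-- **Transport of de Rham-ness to an isogenous curve**: if `W ∼ W'` over `K₀ ⊆ F` and `V_pW|_{Γ_F}` is de Rham,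
then so is `V_pW'|_{Γ_F}`. [cite: SilvermanAEC2009, Prop. III.7.1(a) and Thm. III.7.4]
[cite: FontaineAsterisque223III, Exp. III §1.5] -/
theorem isDeRham_restrictedRationalTateRep_of_isIsogenous (h : IsIsogenous W W')
    (hW : GaloisRep.IsDeRham (bdRPeriodRingData (F := F) (p := p) hp) (restrictedRationalTateRep W F p)) :
    GaloisRep.IsDeRham (bdRPeriodRingData (F := F) (p := p) hp) (restrictedRationalTateRep W' F p) :=
  (isDeRham_restrictedRationalTateRep_iff_of_isIsogenous hp h).1 hW

end Literature.NumberTheory.PAdicHodge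

end
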